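import Mathlib
import Summits.Ventures.PercRepro2.SepSplitRule

/-!
# Gluing at a general separator, VIII: the orbit sums vanish when a root's glued part is frozen
by the far data — a root behind the separator, off the separator (blind cell PercRepro2, mine-2
g49, 2026-08-29; `conjectures/MINE-2.md` M2-99)

A far-side mark that is not joined to any separator vertex in the far datum (`OffSep`) reaches
the other marks only inside the far side (`connS_left_of_offSep`, `connS_right_of_offSep`), so
its part of the glued state is read from the far datum alone: for `a₂` the `(q′, H_o, H_b, H₃)`
part is `frozenH side p`, for `a₁` the `(q′, L_o, L_b, L₃)` part is `frozenL side p`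
(`gluedS_eq_mkSt_of_offSep_a2`, `gluedS_eq_mkSt_of_offSep_a1`).  The `S₃`-orbit sum of the glued root
counts of a data triple is the typed count of the `S₃`-symmetrised kernel on the three glued
states of the three copies (`orbitRootS_eq_typedCount_KBsym`, by the copy symmetry of the typed
count).  Hence, when one root is off the separator in all three far data and its frozen parts
coincide, the orbit sum is ZERO — realised or not, on every root side
(`orbitRootS_eq_zero_of_offSep_a2`, `orbitRootS_eq_zero_of_offSep_a1`, by the vanishing of the
symmetrised kernel on state triples with a common root part, `KBsym_eq_zero_of_H / _L`).  The
case of record: a root ISOLATED in the three far data (`IsoFar`;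
`orbitRootS_eq_zero_of_isoFar_a2`, `orbitRootS_eq_zero_of_isoFar_a1`), and a far datum joining
the two roots (`orbitRootS_eq_zero_of_joined`).  Own work; standard axioms.
-/

namespace Summit.Ventures.PercRepro2

open UnionCluster

namespace CovForm

namespace RootBridge

open OneTyped TypedA3 Untouched TypedFactor Separated

/-! ## A far mark off the separator: its glued connections are read from the far datum alone -/

section Frozen

open Classical

variable {ι : Type*}

/-- The mark `r` is not joined to any separator vertex in the side datum `p`. -/
def OffSep (p : SideData ι) (r : Fin 5) : Prop := ∀ i, p.2.1 i r = false

/-- A far-side mark off the separator reaches another mark only directly inside the far side. -/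
lemma connS_left_of_offSep (h p : SideData ι) (side : Fin 5 → Bool) {r : Fin 5}
    (hr : side r = true) (hoff : OffSep p r) (l : Fin 5) :
    connS h p side r l ↔ (side l && p.1 r l) = true := by
  unfold connS
  rw [if_pos hr]
  by_cases hl : side l = true
  · rw [if_pos hl]
    constructor
    · rintro (h1 | ⟨i, j, hi, _, _⟩)
      · simp [hl, h1]
      · simp [hoff i] at hi
    · intro h1
      simp only [Bool.and_eq_true] at h1
      exact Or.inl h1.2
  · rw [if_neg hl]
    constructor
    · rintro ⟨i, j, _, _, hj⟩
      simp [hoff j] at hj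
    · intro h1
      simp only [Bool.and_eq_true] at h1
      exact absurd h1.1 hl

/-- Another mark reaches a far-side mark off the separator only directly inside the far side. -/
lemma connS_right_of_offSep (h p : SideData ι) (side : Fin 5 → Bool) {r : Fin 5}
    (hr : side r = true) (hoff : OffSep p r) (k : Fin 5) :
    connS h p side k r ↔ (side k && p.1 k r) = true := by
  unfold connS
  by_cases hk : side k = true
  · rw [if_pos hk, if_pos hr]
    constructor
    · rintro (h1 | ⟨i, j, _, _, hj⟩)
      · simp [hk, h1]
      · simp [hoff j] at hj
    · intro h1
      simp only [Bool.and_eq_true] at h1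
      exact Or.inl h1.2
  · rw [if_neg hk, if_pos hr]
    constructor
    · rintro ⟨i, j, _, _, hj⟩
      simp [hoff j] at hj
    · intro h1
      simp only [Bool.and_eq_true] at h1
      exact absurd h1.1 hk

/-- The decided form of `connS_left_of_offSep`. -/
lemma decide_connS_left_of_offSep (h p : SideData ι) (side : Fin 5 → Bool) {r : Fin 5}
    (hr : side r = true) (hoff : OffSep p r) (l : Fin 5) :
    decide (connS h p side r l) = (side l && p.1 r l) := by
  rw [Bool.eq_iff_iff, decide_eq_true_iff]
  exact connS_left_of_offSep h p side hr hoff l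

/-- The decided form of `connS_right_of_offSep`. -/
lemma decide_connS_right_of_offSep (h p : SideData ι) (side : Fin 5 → Bool) {r : Fin 5}
    (hr : side r = true) (hoff : OffSep p r) (k : Fin 5) :
    decide (connS h p side k r) = (side k && p.1 k r) := by
  rw [Bool.eq_iff_iff, decide_eq_true_iff]
  exact connS_right_of_offSep h p side hr hoff k

/-- The `a₂`-part `(q′, H_o, H_b, H₃)` of the glued state read from the far datum alone. -/
def frozenH (side : Fin 5 → Bool) (p : SideData ι) : Bool × Bool × Bool × Bool :=
  (side 1 && p.1 2 1, side 0 && p.1 2 0, side 4 && p.1 2 4, side 3 && p.1 2 3)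

/-- The `a₁`-part `(q′, L_o, L_b, L₃)` of the glued state read from the far datum alone. -/
def frozenL (side : Fin 5 → Bool) (p : SideData ι) : Bool × Bool × Bool × Bool :=
  (side 2 && p.1 2 1, side 0 && p.1 1 0, side 4 && p.1 1 4, side 3 && p.1 1 3)

/-- With `a₂` a far mark off the separator, the glued state has the frozen `a₂`-part. -/
lemma gluedS_eq_mkSt_of_offSep_a2 (h p : SideData ι) (side : Fin 5 → Bool) (h2 : side 2 = true)
    (hoff : OffSep p 2) :
    gluedS h p side = mkSt (frozenH side p).1 (decide (connS h p side 1 0))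
      (decide (connS h p side 1 4)) (decide (connS h p side 1 3)) (frozenH side p).2.1
      (frozenH side p).2.2.1 (frozenH side p).2.2.2 := by
  unfold gluedS mkSt frozenH
  rw [decide_connS_left_of_offSep h p side h2 hoff 1, decide_connS_left_of_offSep h p side h2 hoff 0,
    decide_connS_left_of_offSep h p side h2 hoff 4, decide_connS_left_of_offSep h p side h2 hoff 3]

/-- With `a₁` a far mark off the separator, the glued state has the frozen `a₁`-part. -/
lemma gluedS_eq_mkSt_of_offSep_a1 (h p : SideData ι) (side : Fin 5 → Bool) (h1 : side 1 = true)
    (hoff : OffSep p 1) :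
    gluedS h p side = mkSt (frozenL side p).1 (frozenL side p).2.1 (frozenL side p).2.2.1
      (frozenL side p).2.2.2 (decide (connS h p side 2 0)) (decide (connS h p side 2 4))
      (decide (connS h p side 2 3)) := by
  unfold gluedS mkSt frozenL
  rw [decide_connS_right_of_offSep h p side h1 hoff 2, decide_connS_left_of_offSep h p side h1 hoff 0,
    decide_connS_left_of_offSep h p side h1 hoff 4, decide_connS_left_of_offSep h p side h1 hoff 3]

/-- The mark `r` is ISOLATED among the far vertices of the side datum `p`: off the separator and
joined to no other far-side mark. -/
def IsoFar (side : Fin 5 → Bool) (p : SideData ι) (r : Fin 5) : Prop :=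
  OffSep p r ∧ ∀ l, side l = true → l ≠ r → p.1 r l = false ∧ p.1 l r = false

/-- An isolated `a₂` has the all-`false` frozen part. -/
lemma frozenH_eq_of_isoFar (side : Fin 5 → Bool) (p : SideData ι) (h : IsoFar side p 2) :
    frozenH side p = (false, false, false, false) := by
  unfold frozenH
  have e : ∀ l, l ≠ 2 → (side l && p.1 2 l) = false := fun l hl => by
    by_cases hs : side l = true
    · rw [(h.2 l hs hl).1]; simp
    · simp only [Bool.not_eq_true] at hs
      rw [hs]; simp
  rw [e 1 (by decide), e 0 (by decide), e 4 (by decide), e 3 (by decide)]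

/-- An isolated `a₁` has the all-`false` frozen part. -/
lemma frozenL_eq_of_isoFar (side : Fin 5 → Bool) (p : SideData ι) (h : IsoFar side p 1) :
    frozenL side p = (false, false, false, false) := by
  unfold frozenL
  have e : ∀ l, l ≠ 1 → (side l && p.1 1 l) = false := fun l hl => by
    by_cases hs : side l = true
    · rw [(h.2 l hs hl).1]; simp
    · simp only [Bool.not_eq_true] at hs
      rw [hs]; simp
  have e2 : (side 2 && p.1 2 1) = false := by
    by_cases hs : side 2 = true
    · rw [(h.2 2 hs (by decide)).2]; simp
    · simp only [Bool.not_eq_true] at hs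
      rw [hs]; simp
  rw [e2, e 0 (by decide), e 4 (by decide), e 3 (by decide)]

/-- A far datum joining the two far roots forces `q′` in the glued state. -/
lemma gluedS_q'_of_joined (h p : SideData ι) (side : Fin 5 → Bool) (h1 : side 1 = true)
    (h2 : side 2 = true) (hp : p.1 2 1 = true) : (gluedS h p side).q' = true := by
  unfold gluedS St.q'
  simp only
  rw [decide_eq_true_eq]
  unfold connS
  rw [if_pos h2, if_pos h1]
  exact Or.inl hp

end Frozen

/-! ## The orbit sum as a typed count of the symmetrised kernel on the glued states -/

section Diagonal

open Classical

variable {V : Type*} {E : Type*} {ι : Type*} [Fintype E] [DecidableEq E] {R : Type*} [Field R]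
variable (ends : E → Sym2 V) (mk : Fin 5 → V) (σ : ι → V)

/-- The glued state of a root-side configuration `x` with the far datum `q`. -/
noncomputable def gst (side : Fin 5 → Bool) (VH : Set V) (q : SideData ι) (x : Config E) : St :=
  gluedS (sideData ends mk σ (withinRestr ends VH x)) q side

omit [Fintype E] [DecidableEq E] in
/-- The root-side kernel through the glued states. -/
lemma rootKS_eq_gst (side : Fin 5 → Bool) (VH : Set V) (p : Pat3S ι) (x y w : Config E) :
    rootKS ends mk σ side VH p x y w =
      ((KB (gst ends mk σ side VH p.1 x) (gst ends mk σ side VH p.2.1 y)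
        (gst ends mk σ side VH p.2.2 w) : ℤ) : R) := rfl

/-- **The orbit sum on the diagonal**: the `S₃`-orbit sum of the glued root counts of a data
triple is the typed count of the `S₃`-symmetrised kernel on the three glued states (types in
`{1, 2}` on `B`). -/
theorem orbitRootS_eq_typedCount_KBsym (side : Fin 5 → Bool) (VH : Set V) (B : Finset E)
    (z : Config E) (τ : E → ℕ) (hτ : ∀ e ∈ B, τ e = 1 ∨ τ e = 2) (p : Pat3S ι) :
    orbitRootS ends mk σ side VH B z τ p =
      typedCount B z τ (fun x y w => ((KBsym (gst ends mk σ side VH p.1 x)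
        (gst ends mk σ side VH p.2.1 y) (gst ends mk σ side VH p.2.2 w) : ℤ) : R)) := by
  have t2 : typedCount B z τ
      (rootKS ends mk σ side VH (p.2.1, p.1, p.2.2) : Config E → Config E → Config E → R) =
      typedCount B z τ (fun x y w => ((KB (gst ends mk σ side VH p.2.1 y)
        (gst ends mk σ side VH p.1 x) (gst ends mk σ side VH p.2.2 w) : ℤ) : R)) := by
    rw [← typedCount_swap12 B z τ (fun x y w => ((KB (gst ends mk σ side VH p.2.1 y)
      (gst ends mk σ side VH p.1 x) (gst ends mk σ side VH p.2.2 w) : ℤ) : R))]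
    rfl
  have t3 : typedCount B z τ
      (rootKS ends mk σ side VH (p.1, p.2.2, p.2.1) : Config E → Config E → Config E → R) =
      typedCount B z τ (fun x y w => ((KB (gst ends mk σ side VH p.1 x)
        (gst ends mk σ side VH p.2.2 w) (gst ends mk σ side VH p.2.1 y) : ℤ) : R)) := by
    rw [← typedCount_swap23 B z τ hτ (fun x y w => ((KB (gst ends mk σ side VH p.1 x)
      (gst ends mk σ side VH p.2.2 w) (gst ends mk σ side VH p.2.1 y) : ℤ) : R))]
    rfl
  have t4 : typedCount B z τ
      (rootKS ends mk σ side VH (p.2.2, p.2.1, p.1) : Config E → Config E → Config E → R) =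
      typedCount B z τ (fun x y w => ((KB (gst ends mk σ side VH p.2.2 w)
        (gst ends mk σ side VH p.2.1 y) (gst ends mk σ side VH p.1 x) : ℤ) : R)) := by
    rw [← typedCount_swap13 B z τ hτ (fun x y w => ((KB (gst ends mk σ side VH p.2.2 w)
      (gst ends mk σ side VH p.2.1 y) (gst ends mk σ side VH p.1 x) : ℤ) : R))]
    rfl
  have t5 : typedCount B z τ
      (rootKS ends mk σ side VH (p.2.1, p.2.2, p.1) : Config E → Config E → Config E → R) =
      typedCount B z τ (fun x y w => ((KB (gst ends mk σ side VH p.2.1 y)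
        (gst ends mk σ side VH p.2.2 w) (gst ends mk σ side VH p.1 x) : ℤ) : R)) := by
    have s1 := typedCount_swap12 B z τ (fun x y w => ((KB (gst ends mk σ side VH p.2.1 y)
      (gst ends mk σ side VH p.2.2 x) (gst ends mk σ side VH p.1 w) : ℤ) : R))
    have s2 := typedCount_swap13 B z τ hτ (fun x y w => ((KB (gst ends mk σ side VH p.2.1 y)
      (gst ends mk σ side VH p.2.2 w) (gst ends mk σ side VH p.1 x) : ℤ) : R))
    rw [← s2, ← s1]
    rfl
  have t6 : typedCount B z τ
      (rootKS ends mk σ side VH (p.2.2, p.1, p.2.1) : Config E → Config E → Config E → R) =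
      typedCount B z τ (fun x y w => ((KB (gst ends mk σ side VH p.2.2 w)
        (gst ends mk σ side VH p.1 x) (gst ends mk σ side VH p.2.1 y) : ℤ) : R)) := by
    have s1 := typedCount_swap12 B z τ (fun x y w => ((KB (gst ends mk σ side VH p.2.2 y)
      (gst ends mk σ side VH p.1 x) (gst ends mk σ side VH p.2.1 w) : ℤ) : R))
    have s2 := typedCount_swap23 B z τ hτ (fun x y w => ((KB (gst ends mk σ side VH p.2.2 w)
      (gst ends mk σ side VH p.1 x) (gst ends mk σ side VH p.2.1 y) : ℤ) : R))
    rw [← s2, ← s1]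
    rfl
  have t1 : typedCount B z τ
      (rootKS ends mk σ side VH p : Config E → Config E → Config E → R) =
      typedCount B z τ (fun x y w => ((KB (gst ends mk σ side VH p.1 x)
        (gst ends mk σ side VH p.2.1 y) (gst ends mk σ side VH p.2.2 w) : ℤ) : R)) := rfl
  unfold orbitRootS orbitSumG
  dsimp only
  rw [t1, t2, t3, t4, t5, t6]
  rw [← typedCount_add', ← typedCount_add', ← typedCount_add', ← typedCount_add',
    ← typedCount_add']
  refine typedCount_congr' _ _ _ _ _ fun x y w => ?_
  unfold KBsym
  push_cast
  ring

end Diagonal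

/-! ## The vanishing theorems -/

section Vanishing

open Classical

variable {V : Type*} {E : Type*} {ι : Type*} [Fintype E] [DecidableEq E] {R : Type*} [Field R]
variable (ends : E → Sym2 V) (mk : Fin 5 → V) (σ : ι → V)

/-- **The orbit sum vanishes when `a₂` is off the separator in the three far data with one and
the same frozen part**, on every root side (types in `{1, 2}`), realised or not. -/
theorem orbitRootS_eq_zero_of_offSep_a2 (side : Fin 5 → Bool) (h2 : side 2 = true) (VH : Set V)
    (B : Finset E) (z : Config E) (τ : E → ℕ) (hτ : ∀ e ∈ B, τ e = 1 ∨ τ e = 2) (p : Pat3S ι)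
    (hoff : OffSep p.1 2 ∧ OffSep p.2.1 2 ∧ OffSep p.2.2 2)
    (hsame : frozenH side p.1 = frozenH side p.2.2 ∧ frozenH side p.2.1 = frozenH side p.2.2) :
    orbitRootS ends mk σ side VH B z τ p = (0 : R) := by
  rw [orbitRootS_eq_typedCount_KBsym ends mk σ side VH B z τ hτ p, ← typedCount_zero_kernel B z τ]
  refine typedCount_congr' _ _ _ _ _ fun x y w => ?_
  unfold gst
  rw [gluedS_eq_mkSt_of_offSep_a2 _ _ side h2 hoff.1, gluedS_eq_mkSt_of_offSep_a2 _ _ side h2 hoff.2.1,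
    gluedS_eq_mkSt_of_offSep_a2 _ _ side h2 hoff.2.2, hsame.1, hsame.2, KBsym_eq_zero_of_H]
  simp

/-- **The orbit sum vanishes when `a₁` is off the separator in the three far data with one and
the same frozen part**, on every root side (types in `{1, 2}`), realised or not. -/
theorem orbitRootS_eq_zero_of_offSep_a1 (side : Fin 5 → Bool) (h1 : side 1 = true) (VH : Set V)
    (B : Finset E) (z : Config E) (τ : E → ℕ) (hτ : ∀ e ∈ B, τ e = 1 ∨ τ e = 2) (p : Pat3S ι)
    (hoff : OffSep p.1 1 ∧ OffSep p.2.1 1 ∧ OffSep p.2.2 1)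
    (hsame : frozenL side p.1 = frozenL side p.2.2 ∧ frozenL side p.2.1 = frozenL side p.2.2) :
    orbitRootS ends mk σ side VH B z τ p = (0 : R) := by
  rw [orbitRootS_eq_typedCount_KBsym ends mk σ side VH B z τ hτ p, ← typedCount_zero_kernel B z τ]
  refine typedCount_congr' _ _ _ _ _ fun x y w => ?_
  unfold gst
  rw [gluedS_eq_mkSt_of_offSep_a1 _ _ side h1 hoff.1, gluedS_eq_mkSt_of_offSep_a1 _ _ side h1 hoff.2.1,
    gluedS_eq_mkSt_of_offSep_a1 _ _ side h1 hoff.2.2, hsame.1, hsame.2, KBsym_eq_zero_of_L]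
  simp

/-- **`a₂` isolated in the three far data ⟹ the orbit sum is zero.** -/
theorem orbitRootS_eq_zero_of_isoFar_a2 (side : Fin 5 → Bool) (h2 : side 2 = true) (VH : Set V)
    (B : Finset E) (z : Config E) (τ : E → ℕ) (hτ : ∀ e ∈ B, τ e = 1 ∨ τ e = 2) (p : Pat3S ι)
    (hiso : IsoFar side p.1 2 ∧ IsoFar side p.2.1 2 ∧ IsoFar side p.2.2 2) :
    orbitRootS ends mk σ side VH B z τ p = (0 : R) :=
  orbitRootS_eq_zero_of_offSep_a2 ends mk σ side h2 VH B z τ hτ p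
    ⟨hiso.1.1, hiso.2.1.1, hiso.2.2.1⟩
    ⟨by rw [frozenH_eq_of_isoFar side p.1 hiso.1, frozenH_eq_of_isoFar side p.2.2 hiso.2.2],
      by rw [frozenH_eq_of_isoFar side p.2.1 hiso.2.1, frozenH_eq_of_isoFar side p.2.2 hiso.2.2]⟩

/-- **`a₁` isolated in the three far data ⟹ the orbit sum is zero.** -/
theorem orbitRootS_eq_zero_of_isoFar_a1 (side : Fin 5 → Bool) (h1 : side 1 = true) (VH : Set V)
    (B : Finset E) (z : Config E) (τ : E → ℕ) (hτ : ∀ e ∈ B, τ e = 1 ∨ τ e = 2) (p : Pat3S ι)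
    (hiso : IsoFar side p.1 1 ∧ IsoFar side p.2.1 1 ∧ IsoFar side p.2.2 1) :
    orbitRootS ends mk σ side VH B z τ p = (0 : R) :=
  orbitRootS_eq_zero_of_offSep_a1 ends mk σ side h1 VH B z τ hτ p
    ⟨hiso.1.1, hiso.2.1.1, hiso.2.2.1⟩
    ⟨by rw [frozenL_eq_of_isoFar side p.1 hiso.1, frozenL_eq_of_isoFar side p.2.2 hiso.2.2],
      by rw [frozenL_eq_of_isoFar side p.2.1 hiso.2.1, frozenL_eq_of_isoFar side p.2.2 hiso.2.2]⟩

omit [Fintype E] [DecidableEq E] in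
/-- A root-side kernel with a far datum joining the two far roots vanishes pointwise. -/
lemma rootKS_eq_zero_of_joined (side : Fin 5 → Bool) (h1 : side 1 = true) (h2 : side 2 = true)
    (VH : Set V) (q : Pat3S ι) (hq : q.1.1 2 1 = true ∨ q.2.1.1 2 1 = true ∨ q.2.2.1 2 1 = true)
    (x y w : Config E) : rootKS ends mk σ side VH q x y w = (0 : R) := by
  unfold rootKS
  rw [KB_eq_zero_of_q']
  · simp
  · rcases hq with hq | hq | hq
    · exact Or.inl (gluedS_q'_of_joined _ _ side h1 h2 hq)
    · exact Or.inr (Or.inl (gluedS_q'_of_joined _ _ side h1 h2 hq))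
    · exact Or.inr (Or.inr (gluedS_q'_of_joined _ _ side h1 h2 hq))

/-- The root count of a data triple with a far datum joining the two far roots vanishes. -/
lemma typedCount_rootKS_eq_zero_of_joined (side : Fin 5 → Bool) (h1 : side 1 = true)
    (h2 : side 2 = true) (VH : Set V) (B : Finset E) (z : Config E) (τ : E → ℕ) (q : Pat3S ι)
    (hq : q.1.1 2 1 = true ∨ q.2.1.1 2 1 = true ∨ q.2.2.1 2 1 = true) :
    typedCount B z τ (rootKS ends mk σ side VH q : Config E → Config E → Config E → R) = 0 := by
  rw [← typedCount_zero_kernel B z τ]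
  exact typedCount_congr' _ _ _ _ _ fun x y w =>
    rootKS_eq_zero_of_joined ends mk σ side h1 h2 VH q hq x y w

/-- **A far datum joining the two far roots ⟹ the orbit sum is zero** (every permutation carries
the `q′`-state). -/
theorem orbitRootS_eq_zero_of_joined (side : Fin 5 → Bool) (h1 : side 1 = true)
    (h2 : side 2 = true) (VH : Set V) (B : Finset E) (z : Config E) (τ : E → ℕ) (p : Pat3S ι)
    (hp : p.1.1 2 1 = true ∨ p.2.1.1 2 1 = true ∨ p.2.2.1 2 1 = true) :
    orbitRootS ends mk σ side VH B z τ p = (0 : R) := by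
  unfold orbitRootS orbitSumG
  dsimp only
  rw [typedCount_rootKS_eq_zero_of_joined ends mk σ side h1 h2 VH B z τ p hp,
    typedCount_rootKS_eq_zero_of_joined ends mk σ side h1 h2 VH B z τ (p.2.1, p.1, p.2.2)
      (by tauto),
    typedCount_rootKS_eq_zero_of_joined ends mk σ side h1 h2 VH B z τ (p.1, p.2.2, p.2.1)
      (by tauto),
    typedCount_rootKS_eq_zero_of_joined ends mk σ side h1 h2 VH B z τ (p.2.2, p.2.1, p.1)
      (by tauto),
    typedCount_rootKS_eq_zero_of_joined ends mk σ side h1 h2 VH B z τ (p.2.1, p.2.2, p.1)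
      (by tauto),
    typedCount_rootKS_eq_zero_of_joined ends mk σ side h1 h2 VH B z τ (p.2.2, p.1, p.2.1)
      (by tauto)]
  ring

end Vanishing

end RootBridge

end CovForm

end Summit.Ventures.PercRepro2
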